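import Summits.Ventures.HSemireg.WedgeHankelRecurrenceGaussChebyshevCharP

/-!
# Venture HSemireg — **THE SECOND-KIND CONGRUENCE `U_{p−1} = (X² − 1)^{(p−1)∕2}` IN EVERY COMMUTATIVE RING OF ODD PRIME CHARACTERISTIC `p`** (so `U_{p−1}(x) ≡ (x² − 1)^{(p−1)∕2} ≡`
# the Legendre symbol of `x² − 1` modulo `p` for `x ∈ 𝔽_p` with `x² ≠ 1`): from the Pell identity `T_p² − (X² − 1) U_{p−1}² = 1`, the Chebyshev–Fermat congruence `T_p = X^p` (N473) and
# Frobenius `(X² − 1)^p = X^{2p} − 1`, one gets `(X² − 1)(U_{p−1}² − (X² − 1)^{p−1}) = 0`; over `𝔽_p[X]` cancel, take the square root and fix the sign by leading coefficients, then map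

HONEST FRAMING. Part of the Lean index of the computation cell `pub-hsemireg` (seat p10 gen 48, Sunday typer «UNIFORM-IN-n»).  Polynomial algebra in characteristic `p` only; no variety, no
cohomology theory, no sheaf, no Ext group and no semiregularity map is constructed here; nothing here says that HC / HC_CM / HC_AV holds; no Literature fact (unproved `Prop`) is declared or
used.  Custodian versions as in `WedgeHankelSiegelIdeal` (1/3).
SOURCES (cited).  I. Schur, *Arithmetisches über die Tschebyscheffschen Polynome* (1931); T. J. Rivlin, *Chebyshev Polynomials* (1990), §5.2; R. Lidl, H. Niederreiter, *Finite Fields* (1997), §7.2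
(Dickson polynomials of the second kind modulo `p`).  Checked by hand: `U_2 = 4x² − 1 ≡ x² − 1 (mod 3)`, `U_4 = 16x⁴ − 12x² + 1 ≡ (x² − 1)² (mod 5)`.
PROOF TYPED HERE.  N443 `chebyshev_pell`; N473 `chebyshevT_eq_X_pow_charP`; Mathlib `sub_pow_char` (with `Polynomial.instCharP`), `sq_eq_sq_iff_eq_or_eq_neg`, `leadingCoeff_U_natCast`,
`monic_X_pow_sub_C`, `X_pow_sub_C_ne_zero`, `ZMod.natCast_eq_zero_iff`, `map_U`.
DEDUP DISCLOSURE (`rg -n 'zmod_prime_two_ne_zero_iff|chebyshevU_pred_eq_pow_zmod|chebyshevU_pred_eq_pow_charP|chebyshevU_pred_eval_zmod' Summits Literature HarnessLib`, 2026-09-04): 0 hits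
for the 4 names below (a BSD summit file has a one-directional `zmod_two_ne_zero_of_prime_ne_two` in another namespace; the iff here is a different statement).

WHAT IS IN THE TREE.  N443, N473.
THIS FILE (namespace `Summit.Ventures.HSemireg.Wedge.HankelOuter` continued; CHAINED on N473; 0 definitions):
* §1239 `zmod_prime_two_ne_zero_iff`, **`chebyshevU_pred_eq_pow_zmod`**, **`chebyshevU_pred_eq_pow_charP`**, `chebyshevU_pred_eval_zmod`.
CAVEATS.  `p` odd.  Nothing Ext-side.  New names only.
-/

open Module Polynomial
open scoped Matrix Polynomial

namespace Summit.Ventures.HSemireg.Wedge.HankelOuter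

/-! ## §1239. `U_{p−1} ≡ (X² − 1)^{(p−1)∕2} (mod p)` -/

/-- `2 ≠ 0` in `𝔽_p` iff the prime `p` is odd. [bookkeeping; this file, §1239] -/
theorem zmod_prime_two_ne_zero_iff (p : ℕ) [hp : Fact p.Prime] : (2 : ZMod p) ≠ 0 ↔ p ≠ 2 := by
  constructor
  · rintro h rfl
    exact h rfl
  · intro hp2 h
    have h' : ((2 : ℕ) : ZMod p) = 0 := by exact_mod_cast h
    rw [ZMod.natCast_eq_zero_iff] at h'
    have := Nat.le_of_dvd (by norm_num) h'
    have := hp.out.two_le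
    omega

/-- **`U_{p−1} = (X² − 1)^{(p−1)∕2}` in `𝔽_p[X]`** (`p` an odd prime). [Schur 1931; Lidl–Niederreiter §7.2; this file, §1239] -/
theorem chebyshevU_pred_eq_pow_zmod (p : ℕ) [hp : Fact p.Prime] (hp2 : p ≠ 2) :
    Polynomial.Chebyshev.U (ZMod p) ((p : ℤ) - 1) = (Polynomial.X ^ 2 - 1) ^ ((p - 1) / 2) := by
  haveI : NeZero (2 : ZMod p) := ⟨(zmod_prime_two_ne_zero_iff p).2 hp2⟩
  have hq : p - 1 = 2 * ((p - 1) / 2) := (Nat.two_mul_div_two_of_even (hp.out.even_sub_one hp2)).symm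
  -- Pell + Chebyshev–Fermat + Frobenius
  have hpell := chebyshev_pell (R := ZMod p) ((p : ℤ) - 1)
  rw [sub_add_cancel, chebyshevT_eq_X_pow_charP (ZMod p) p hp2] at hpell
  have hfrob : (Polynomial.X ^ 2 - 1 : (ZMod p)[X]) ^ p = (Polynomial.X ^ p) ^ 2 - 1 := by
    rw [sub_pow_char, one_pow, ← pow_mul, ← pow_mul, mul_comm]
  have hpow : (Polynomial.X ^ 2 - 1 : (ZMod p)[X]) * ((Polynomial.X ^ 2 - 1) ^ ((p - 1) / 2)) ^ 2 = (Polynomial.X ^ 2 - 1) ^ p := by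
    rw [← pow_mul, mul_comm ((p - 1) / 2) 2, ← hq, ← pow_succ', Nat.sub_add_cancel hp.out.one_le]
  have key : (Polynomial.X ^ 2 - 1 : (ZMod p)[X]) * Polynomial.Chebyshev.U (ZMod p) ((p : ℤ) - 1) ^ 2 =
      (Polynomial.X ^ 2 - 1) * ((Polynomial.X ^ 2 - 1) ^ ((p - 1) / 2)) ^ 2 := by
    rw [hpow, hfrob]
    linear_combination (-1 : (ZMod p)[X]) * hpell
  have hne : (Polynomial.X ^ 2 - 1 : (ZMod p)[X]) ≠ 0 := by
    rw [← C_1]; exact Polynomial.X_pow_sub_C_ne_zero (by norm_num) (1 : ZMod p)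
  rcases sq_eq_sq_iff_eq_or_eq_neg.1 (mul_left_cancel₀ hne key) with h | h
  · exact h
  · -- the sign: leading coefficients `2^{p−1} = 1` versus `−1`
    exfalso
    have hmonic : ((Polynomial.X ^ 2 - 1 : (ZMod p)[X]) ^ ((p - 1) / 2)).Monic := by
      rw [← C_1]; exact (Polynomial.monic_X_pow_sub_C (1 : ZMod p) two_ne_zero).pow _
    have hlc := congrArg Polynomial.leadingCoeff h
    rw [show (p : ℤ) - 1 = ((p - 1 : ℕ) : ℤ) by rw [Nat.cast_sub hp.out.one_le]; simp, Polynomial.Chebyshev.leadingCoeff_U_natCast, leadingCoeff_neg, hmonic.leadingCoeff,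
      two_pow_sub_one_eq_one_of_charP (ZMod p) p hp2] at hlc
    have h2 : (2 : ZMod p) = 0 := by linear_combination hlc
    exact (zmod_prime_two_ne_zero_iff p).2 hp2 h2

/-- **`U_{p−1} = (X² − 1)^{(p−1)∕2}` in every commutative ring of odd prime characteristic `p`.** [this file, §1239] -/
theorem chebyshevU_pred_eq_pow_charP (R : Type*) [CommRing R] (p : ℕ) [Fact p.Prime] [CharP R p] (hp2 : p ≠ 2) :
    Polynomial.Chebyshev.U R ((p : ℤ) - 1) = (Polynomial.X ^ 2 - 1) ^ ((p - 1) / 2) := by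
  have h := congrArg (Polynomial.map (ZMod.castHom (dvd_refl p) R)) (chebyshevU_pred_eq_pow_zmod p hp2)
  rw [Polynomial.Chebyshev.map_U, Polynomial.map_pow, Polynomial.map_sub, Polynomial.map_pow, Polynomial.map_X, Polynomial.map_one] at h
  exact h

/-- `U_{p−1}(x) = (x² − 1)^{(p−1)∕2}` for `x ∈ 𝔽_p` (Euler's criterion form: the Legendre symbol of `x² − 1` when `x² ≠ 1`). [this file, §1239] -/
theorem chebyshevU_pred_eval_zmod (p : ℕ) [Fact p.Prime] (hp2 : p ≠ 2) (x : ZMod p) :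
    (Polynomial.Chebyshev.U (ZMod p) ((p : ℤ) - 1)).eval x = (x ^ 2 - 1) ^ ((p - 1) / 2) := by
  rw [chebyshevU_pred_eq_pow_zmod p hp2, eval_pow, eval_sub, eval_pow, eval_X, eval_one]

end Summit.Ventures.HSemireg.Wedge.HankelOuter
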